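import Summits.Ventures.PercRepro.ProfilePointedCircuitClassesStarNineB
import Summits.Ventures.PercRepro.ProfilePointedCircuitClassesInOutFiveCircuit
import Summits.Ventures.PercRepro.ProfilePointedCircuitClassesInOutTriangleSix

/-!
# PercRepro — `(★_3)` AT NINE POINTS, THE BASIS CASE, III: THE ASSEMBLY, AND THE SINGLE 4-CIRCUIT CASE OF
`InOutBottomFour` AT `ρ = 6` (p5, gen 39; `proofs/P5-GM1.md` §58 ADDENDUM 1 (2))

`two_mul_card_good_le_card_biSpanning_add_two` (the dual `R`, `C₀ = {f, g, k}` a basis, `H₀` spanning):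
`2·#good ≤ #BS + 2` from the three families of StarNineA/B — with `p = #par ≤ a_f + a_g + a_k`: if two of the
`a_c` are positive, `#T₂ + 3 ≥ a_f + a_g + a_k`; if at most one is, `p ≤ a_c`, and either `a_c ≤ 3` or family three
supplies `a_c` more triples.  Transported by duality (`star_core_of_nine_of_biIndep`), with `star_core_of_nine_of_not_biIndep`
(InOutFourCircuit) it gives **`star_core_of_nine`** — `(★_C)` for every `3`-set `C₀` on every coloop-free nullity-`3`
matroid on `9` points — hence **`inCount_four_le_outCount_five_of_fourCircuit_of_six'`**: the single 4-circuit
case of `InOutBottomFour` at `ρ = 6`, with no condition on `E − C`.  With the triangle case (InOutTriangleSix) and the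
5-circuit case (InOutFiveCircuit): **`inCount_four_le_outCount_five_of_single_short_circuit_of_six`** — at `#E = 10`,
`in_4(e) ≤ out_5(e)` at every point `e` (with `E − e` loopless and coloop-free) whose circuits with `≤ 5` elements
are all equal to one circuit `C₀ + e`.
-/

open scoped Matroid

namespace PercRepro.Cogirth

open Finset ThmH Skew Shadow Profile

variable {α : Type} [DecidableEq α]

section Arith

/-- `xy + xz + yz + 3 ≥ x + y + z` when two of `x, y, z` are positive. -/
theorem arith_two_pos {x y z : ℕ} (h : (1 ≤ x ∧ 1 ≤ y) ∨ (1 ≤ x ∧ 1 ≤ z) ∨ (1 ≤ y ∧ 1 ≤ z)) :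
    x + y + z ≤ x * y + x * z + y * z + 3 := by
  rcases h with ⟨hx, hy⟩ | ⟨hx, hz⟩ | ⟨hy, hz⟩
  · obtain ⟨x', rfl⟩ := Nat.exists_eq_add_of_le hx
    obtain ⟨y', rfl⟩ := Nat.exists_eq_add_of_le hy
    nlinarith [Nat.zero_le (x' * y'), Nat.zero_le (x' * z), Nat.zero_le (y' * z)]
  · obtain ⟨x', rfl⟩ := Nat.exists_eq_add_of_le hx
    obtain ⟨z', rfl⟩ := Nat.exists_eq_add_of_le hz
    nlinarith [Nat.zero_le (x' * y), Nat.zero_le (x' * z'), Nat.zero_le (y * z')]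
  · obtain ⟨y', rfl⟩ := Nat.exists_eq_add_of_le hy
    obtain ⟨z', rfl⟩ := Nat.exists_eq_add_of_le hz
    nlinarith [Nat.zero_le (x * y'), Nat.zero_le (x * z'), Nat.zero_le (y' * z')]

end Arith

section Assembly

variable {R : Matroid α} [R.Finite] {f g k : α}

/-- **THE BASIS CASE IN THE DUAL**: `2·#good ≤ #BS + 2`. -/
theorem two_mul_card_good_le_card_biSpanning_add_two (hll : ∀ x ∈ gr R, rk R {x} = 1) (hR3 : rk R (gr R) = 3)
    (h9 : (gr R).card = 9) (hf : f ∈ gr R) (hg : g ∈ gr R) (hk : k ∈ gr R) (hfg : f ≠ g) (hfk : f ≠ k)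
    (hgk : g ≠ k) (hC : rk R {f, g, k} = 3) (hH : rk R (gr R \ {f, g, k}) = 3) :
    2 * ((gr R \ {f, g, k}).filter (fun z => rk R ((gr R \ {f, g, k}).erase z) = 3)).card ≤
      (((gr R).powersetCard 3).filter (fun Y => rk R Y = 3 ∧ rk R (gr R \ Y) = 3)).card + 2 := by
  obtain ⟨T₁, hT₁, h₁, hcount₁⟩ := exists_family_one hll hR3 hf hg hk hfg hfk hgk hC
  obtain ⟨T₂, hT₂, h₂, hcount₂⟩ := exists_family_two hll hR3 hf hg hk hfg hfk hgk hC hH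
  have hCE : ({f, g, k} : Finset α) ⊆ gr R := insert_subset hf (insert_subset hg (singleton_subset_iff.2 hk))
  -- `C₀ ∈ BS`
  have hC₀ : ({f, g, k} : Finset α) ∈ ((gr R).powersetCard 3).filter (fun Y => rk R Y = 3 ∧ rk R (gr R \ Y) = 3) := by
    rw [mem_filter, mem_powersetCard]
    exact ⟨⟨hCE, card_triple_of_ne hfg hfk hgk⟩, hC, hH⟩
  have hC₀3 : (({f, g, k} : Finset α) ∩ {f, g, k}).card = 3 := by rw [inter_self, card_triple_of_ne hfg hfk hgk]
  -- `#par ≤ a_f + a_g + a_k`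
  have hpar : (((gr R \ {f, g, k}).filter (fun z => rk R ((gr R \ {f, g, k}).erase z) = 3)).filter
        (fun z => rk R {f, z} = 1 ∨ rk R {g, z} = 1 ∨ rk R {k, z} = 1)).card ≤
      ((gr R \ {f, g, k}).filter (fun z => rk R {f, z} = 1)).card +
        ((gr R \ {f, g, k}).filter (fun z => rk R {g, z} = 1)).card +
        ((gr R \ {f, g, k}).filter (fun z => rk R {k, z} = 1)).card := by
    calc _ ≤ (((gr R \ {f, g, k}).filter (fun z => rk R {f, z} = 1)) ∪
          ((gr R \ {f, g, k}).filter (fun z => rk R {g, z} = 1)) ∪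
          ((gr R \ {f, g, k}).filter (fun z => rk R {k, z} = 1))).card := by
          apply card_le_card
          intro z hz
          rw [mem_filter, mem_filter] at hz
          rw [mem_union, mem_union, mem_filter, mem_filter, mem_filter]
          rcases hz.2 with h | h | h
          · exact Or.inl (Or.inl ⟨hz.1.1, h⟩)
          · exact Or.inl (Or.inr ⟨hz.1.1, h⟩)
          · exact Or.inr ⟨hz.1.1, h⟩
      _ ≤ _ := (card_union_le _ _).trans (Nat.add_le_add_right (card_union_le _ _) _)
  -- the disjoint union `{C₀} ∪ T₁ ∪ T` for a family `T` with `(Y ∩ C₀).card = m ≠ 2, 3`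
  have hunion : ∀ (T : Finset (Finset α)) (m : ℕ), m ≠ 2 → m ≠ 3 →
      T ⊆ ((gr R).powersetCard 3).filter (fun Y => rk R Y = 3 ∧ rk R (gr R \ Y) = 3) →
      (∀ Y ∈ T, (Y ∩ {f, g, k}).card = m) →
      1 + T₁.card + T.card ≤ (((gr R).powersetCard 3).filter (fun Y => rk R Y = 3 ∧ rk R (gr R \ Y) = 3)).card := by
    intro T m hm2 hm3 hT h
    have hd1 : Disjoint ({({f, g, k} : Finset α)} : Finset (Finset α)) T₁ := by
      rw [disjoint_left]
      intro Y hY hY'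
      rw [mem_singleton] at hY
      have := h₁ Y hY'
      rw [hY] at this
      omega
    have hd2 : Disjoint ({({f, g, k} : Finset α)} ∪ T₁) T := by
      rw [disjoint_left]
      intro Y hY hY'
      have h' := h Y hY'
      rw [mem_union, mem_singleton] at hY
      rcases hY with rfl | hY
      · omega
      · have := h₁ Y hY; omega
    calc 1 + T₁.card + T.card = ({({f, g, k} : Finset α)} ∪ T₁ ∪ T).card := by
          rw [card_union_of_disjoint hd2, card_union_of_disjoint hd1, card_singleton]
      _ ≤ _ := card_le_card (union_subset (union_subset (singleton_subset_iff.2 hC₀) hT₁) hT)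
  have hmain2 := hunion T₂ 1 (by norm_num) (by norm_num) hT₂ h₂
  -- the case of a big class
  have hbig : ∀ c ∈ ({f, g, k} : Finset α),
      (((gr R \ {f, g, k}).filter (fun z => rk R ((gr R \ {f, g, k}).erase z) = 3)).filter
        (fun z => rk R {f, z} = 1 ∨ rk R {g, z} = 1 ∨ rk R {k, z} = 1)).card ≤
        ((gr R \ {f, g, k}).filter (fun z => rk R {c, z} = 1)).card →
      4 ≤ ((gr R \ {f, g, k}).filter (fun z => rk R {c, z} = 1)).card →
      2 * ((gr R \ {f, g, k}).filter (fun z => rk R ((gr R \ {f, g, k}).erase z) = 3)).card ≤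
        (((gr R).powersetCard 3).filter (fun Y => rk R Y = 3 ∧ rk R (gr R \ Y) = 3)).card + 2 := by
    intro c hc hp h4
    obtain ⟨T₃, hT₃, h₃, hcount₃⟩ := exists_family_three hll hR3 h9 hf hg hk hfg hfk hgk hC hH hc h4
    have := hunion T₃ 0 (by norm_num) (by norm_num) hT₃ h₃
    omega
  -- the case analysis on the class sizes
  obtain ⟨af, haf⟩ : ∃ n, n = ((gr R \ {f, g, k}).filter (fun z => rk R {f, z} = 1)).card := ⟨_, rfl⟩
  obtain ⟨ag, hag⟩ : ∃ n, n = ((gr R \ {f, g, k}).filter (fun z => rk R {g, z} = 1)).card := ⟨_, rfl⟩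
  obtain ⟨ak, hak⟩ : ∃ n, n = ((gr R \ {f, g, k}).filter (fun z => rk R {k, z} = 1)).card := ⟨_, rfl⟩
  rw [← haf, ← hag, ← hak] at hpar hcount₂
  have hbigf := hbig f (by simp)
  have hbigg := hbig g (by simp)
  have hbigk := hbig k (by simp)
  rw [← haf] at hbigf
  rw [← hag] at hbigg
  rw [← hak] at hbigk
  by_cases hfg' : 1 ≤ af ∧ 1 ≤ ag
  · have := arith_two_pos (x := af) (y := ag) (z := ak) (Or.inl hfg'); omega
  by_cases hfk' : 1 ≤ af ∧ 1 ≤ ak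
  · have := arith_two_pos (x := af) (y := ag) (z := ak) (Or.inr (Or.inl hfk')); omega
  by_cases hgk' : 1 ≤ ag ∧ 1 ≤ ak
  · have := arith_two_pos (x := af) (y := ag) (z := ak) (Or.inr (Or.inr hgk')); omega
  -- at most one class is nonempty
  rcases Nat.lt_or_ge af 4 with h4f | h4f
  · rcases Nat.lt_or_ge ag 4 with h4g | h4g
    · rcases Nat.lt_or_ge ak 4 with h4k | h4k
      · omega
      · exact hbigk (by omega) h4k
    · exact hbigg (by omega) h4g
  · exact hbigf (by omega) h4f

end Assembly

section Primal

variable {M : Matroid α} [M.Finite]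

/-- **`(★_C)` AT NINE POINTS WHEN `C₀` IS BI-INDEPENDENT** (the basis case, by duality from
`two_mul_card_good_le_card_biSpanning_add_two`). -/
theorem star_core_of_nine_of_biIndep (hn : (gr M).card = rk M (gr M) + 3) (h9 : (gr M).card = 9)
    (hcf : ∀ x ∈ gr M, rk M ((gr M).erase x) = rk M (gr M)) {C₀ : Finset α} (hC : C₀ ⊆ gr M)
    (hC3 : C₀.card = 3) (hCb : C₀ ∈ biIndepSets M 3) :
    ((biIndepSets M 3).filter (fun Y => ¬ C₀ ⊆ Y)).card ≤
      ((biIndepSets M 5).filter (fun Z => ¬ Disjoint Z C₀)).card := by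
  have hgrR : gr M✶ = gr M := gr_dual
  have hR3 : rk M✶ (gr M) = 3 := rk_dual_gr_of_nullity_three hn
  have hR3' : rk M✶ (gr M✶) = 3 := by rw [hgrR]; exact hR3
  have hllR : ∀ x ∈ gr M✶, rk M✶ {x} = 1 := by
    intro x hx
    rw [hgrR] at hx
    exact rk_dual_singleton_of_coloopFree hcf hx
  -- `BI_3(M)` is the set of bi-spanning triples of the dual
  have hBS : biIndepSets M 3 = ((gr M).powersetCard 3).filter (fun Y => rk M✶ Y = 3 ∧ rk M✶ (gr M \ Y) = 3) := by
    ext Y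
    rw [mem_biIndepSets, mem_filter, mem_powersetCard]
    constructor
    · rintro ⟨hYg, hY3, hYr, hYc⟩
      refine ⟨⟨hYg, hY3⟩, ?_, ?_⟩
      · have := (rk_eq_card_iff_rk_dual_sdiff (M := M) (X := gr M \ Y) sdiff_subset).1 hYc
        rwa [Finset.sdiff_sdiff_eq_self hYg, hR3] at this
      · have := (rk_eq_card_iff_rk_dual_sdiff (M := M) (X := Y) hYg).1 hYr
        rwa [hR3] at this
    · rintro ⟨⟨hYg, hY3⟩, hYr, hYc⟩
      refine ⟨hYg, hY3, ?_, ?_⟩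
      · rw [rk_eq_card_iff_rk_dual_sdiff (M := M) (X := Y) hYg, hR3]; exact hYc
      · rw [rk_eq_card_iff_rk_dual_sdiff (M := M) (X := gr M \ Y) sdiff_subset, Finset.sdiff_sdiff_eq_self hYg, hR3]
        exact hYr
  -- the units by complementation, and `u = #{V ∈ BI_4 : C₀ ⊆ V}`
  rw [card_filter_biIndepSets_five_compl h9 hC]
  have hsplit := card_filter_add_card_filter_not (s := biIndepSets M 4) (fun V => C₀ ⊆ V)
  -- `u ≤ #good`
  obtain ⟨f, g, k, hfg, hfk, hgk, rfl⟩ := card_eq_three.1 hC3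
  have hfE : f ∈ gr M := hC (mem_insert_self f {g, k})
  have hgE : g ∈ gr M := hC (mem_insert_of_mem (mem_insert_self g {k}))
  have hkE : k ∈ gr M := hC (mem_insert_of_mem (mem_insert_of_mem (mem_singleton_self k)))
  rw [mem_biIndepSets] at hCb
  obtain ⟨_, _, hCr, hCc⟩ := hCb
  have hCR : rk M✶ {f, g, k} = 3 := by
    have := (rk_eq_card_iff_rk_dual_sdiff (M := M) (X := gr M \ {f, g, k}) sdiff_subset).1 hCc
    rwa [Finset.sdiff_sdiff_eq_self hC, hR3] at this
  have hHR : rk M✶ (gr M \ {f, g, k}) = 3 := by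
    have := (rk_eq_card_iff_rk_dual_sdiff (M := M) (X := {f, g, k}) hC).1 hCr
    rwa [hR3] at this
  have hu : ((biIndepSets M 4).filter (fun V => ({f, g, k} : Finset α) ⊆ V)).card ≤
      ((gr M \ {f, g, k}).filter (fun z => rk M✶ ((gr M \ {f, g, k}).erase z) = 3)).card := by
    calc _ ≤ (((gr M \ {f, g, k}).filter (fun z => rk M✶ ((gr M \ {f, g, k}).erase z) = 3)).image
            (fun z => insert z ({f, g, k} : Finset α))).card := by
          apply card_le_card
          intro V hV
          rw [mem_filter, mem_biIndepSets] at hV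
          obtain ⟨⟨hVg, hV4, hVr, hVc⟩, hCV⟩ := hV
          have h1 : (V \ {f, g, k}).card = 1 := by
            rw [card_sdiff_of_subset hCV, hV4, card_triple_of_ne hfg hfk hgk]
          obtain ⟨z, hz⟩ := card_eq_one.1 h1
          have hzV : z ∈ V \ {f, g, k} := by rw [hz]; exact mem_singleton_self z
          have hVeq : V = insert z {f, g, k} := by
            ext x
            rw [mem_insert]
            constructor
            · intro hx
              by_cases hxC : x ∈ ({f, g, k} : Finset α)
              · exact Or.inr hxC
              · left
                have : x ∈ V \ {f, g, k} := mem_sdiff.2 ⟨hx, hxC⟩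
                rw [hz, mem_singleton] at this
                exact this
            · rintro (rfl | hx)
              · exact (mem_sdiff.1 hzV).1
              · exact hCV hx
          rw [mem_image]
          refine ⟨z, ?_, ?_⟩
          · rw [mem_filter, mem_sdiff]
            refine ⟨⟨hVg (mem_sdiff.1 hzV).1, (mem_sdiff.1 hzV).2⟩, ?_⟩
            have := (rk_eq_card_iff_rk_dual_sdiff (M := M) (X := V) hVg).1 hVr
            rw [hVeq, sdiff_insert, hR3] at this
            exact this
          · exact hVeq.symm
      _ ≤ _ := card_image_le
  -- the dual count
  have hdual := two_mul_card_good_le_card_biSpanning_add_two hllR hR3' (by rw [hgrR]; exact h9)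
    (by rw [hgrR]; exact hfE) (by rw [hgrR]; exact hgE) (by rw [hgrR]; exact hkE) hfg hfk hgk hCR
    (by rw [hgrR]; exact hHR)
  rw [hgrR] at hdual
  rw [← hBS] at hdual
  -- the demands are `BI_3 − {C₀}`
  have hD : ((biIndepSets M 3).filter (fun Y => ¬ ({f, g, k} : Finset α) ⊆ Y)).card + 1 ≤ (biIndepSets M 3).card := by
    have hmem : ({f, g, k} : Finset α) ∈ biIndepSets M 3 := mem_biIndepSets.2 ⟨hC, card_triple_of_ne hfg hfk hgk, hCr, hCc⟩
    have : (biIndepSets M 3).filter (fun Y => ¬ ({f, g, k} : Finset α) ⊆ Y) ⊆ (biIndepSets M 3).erase {f, g, k} := by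
      intro Y hY
      rw [mem_filter] at hY
      rw [mem_erase]
      exact ⟨fun h => hY.2 (h ▸ Subset.refl _), hY.1⟩
    have := card_le_card this
    rw [card_erase_of_mem hmem] at this
    have hpos : 0 < (biIndepSets M 3).card := card_pos.2 ⟨_, hmem⟩
    omega
  -- the kernel's bottom step
  have hstep := biIndep_step_three_of_nullity_three (N := M) hn (by omega)
  rw [h9] at hstep
  omega

/-- **`(★_C)` AT NINE POINTS FOR EVERY 3-SET `C₀`**: on a coloop-free nullity-`3` matroid on `9` points,
`#{Y ∈ BI_3(M) : C₀ ⊄ Y} ≤ #{Z ∈ BI_5(M) : Z ∩ C₀ ≠ ∅}`. -/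
theorem star_core_of_nine (hn : (gr M).card = rk M (gr M) + 3) (h9 : (gr M).card = 9)
    (hcf : ∀ x ∈ gr M, rk M ((gr M).erase x) = rk M (gr M)) {C₀ : Finset α} (hC : C₀ ⊆ gr M)
    (hC3 : C₀.card = 3) :
    ((biIndepSets M 3).filter (fun Y => ¬ C₀ ⊆ Y)).card ≤
      ((biIndepSets M 5).filter (fun Z => ¬ Disjoint Z C₀)).card := by
  by_cases h : C₀ ∈ biIndepSets M 3
  · exact star_core_of_nine_of_biIndep hn h9 hcf hC hC3 h
  · exact star_core_of_nine_of_not_biIndep hn h9 hcf hC hC3 h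

end Primal

section FourCircuit

variable {N : Matroid α} [N.Finite]

/-- **THE SINGLE 4-CIRCUIT CASE OF `InOutBottomFour` AT `ρ = 6`**: on `#E = 10`, `ρ(E) = 6`, with `E − e` free of
loops and coloops, at a point `e` with `e ∈ cl(C₀)`, `#C₀ = 3`, such that every independent `4`-subset of `E − e`
capturing `e` contains `C₀`, `in_4(e) ≤ out_5(e)`. -/
theorem inCount_four_le_outCount_five_of_fourCircuit_of_six' (hn : (gr N).card = rk N (gr N) + 4)
    (hR : rk N (gr N) = 6) {e : α} (he : e ∈ gr N) (hnc : rk N ((gr N).erase e) = rk N (gr N))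
    (hcf : ∀ x ∈ (gr N).erase e, rk N (((gr N).erase e).erase x) = rk N (gr N))
    {C₀ : Finset α} (hC : C₀ ⊆ (gr N).erase e) (hC3 : C₀.card = 3) (hcl : e ∈ clF N C₀)
    (honly : ∀ X ⊆ (gr N).erase e, X.card + 2 = rk N (gr N) → rk N X = X.card → e ∈ clF N X → C₀ ⊆ X) :
    inCount N 4 e ≤ outCount N 5 e := by
  refine inCount_four_le_outCount_five_of_single_circuit hn he hcl honly ?_
  have hgr : gr (N ＼ ({e} : Set α)) = (gr N).erase e := gr_delete'
  have hrkM : rk (N ＼ ({e} : Set α)) ((gr N).erase e) = rk N (gr N) := by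
    rw [rk_delete (M := N) (e := e) (Subset.refl ((gr N).erase e))]
    exact hnc
  have hnM : (gr (N ＼ ({e} : Set α))).card = rk (N ＼ ({e} : Set α)) (gr (N ＼ ({e} : Set α))) + 3 := by
    rw [hgr, hrkM, card_erase_of_mem he]
    omega
  have h9M : (gr (N ＼ ({e} : Set α))).card = 9 := by
    rw [hgr, card_erase_of_mem he]
    omega
  have hcfM : ∀ x ∈ gr (N ＼ ({e} : Set α)),
      rk (N ＼ ({e} : Set α)) ((gr (N ＼ ({e} : Set α))).erase x) = rk (N ＼ ({e} : Set α)) (gr (N ＼ ({e} : Set α))) := by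
    intro x hx
    rw [hgr] at hx
    rw [hgr, rk_delete (M := N) (e := e) (erase_subset _ _), hrkM]
    exact hcf x hx
  have hCM : C₀ ⊆ gr (N ＼ ({e} : Set α)) := by rw [hgr]; exact hC
  exact star_core_of_nine hnM h9M hcfM hCM hC3

/-- **AT TEN POINTS, EVERY POINT IN AT MOST ONE SHORT CIRCUIT**: on `#E = 10`, `ρ(E) = 6`, with `E − e` free of loops
and coloops, if `C₀ ⊆ E − e` is independent with `2 ≤ #C₀ ≤ 4`, `e ∈ cl(C₀)`, and every independent `4`-subset of
`E − e` capturing `e` contains `C₀` (so `C₀ + e` is the only circuit through `e` with `≤ 5` elements), then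
`in_4(e) ≤ out_5(e)`. -/
theorem inCount_four_le_outCount_five_of_single_short_circuit_of_six (hn : (gr N).card = rk N (gr N) + 4)
    (hR : rk N (gr N) = 6) {e : α} (he : e ∈ gr N) (hnc : rk N ((gr N).erase e) = rk N (gr N))
    (hll : ∀ x ∈ (gr N).erase e, rk N {x} = 1)
    (hcf : ∀ x ∈ (gr N).erase e, rk N (((gr N).erase e).erase x) = rk N (gr N))
    {C₀ : Finset α} (hC : C₀ ⊆ (gr N).erase e) (hC2 : 2 ≤ C₀.card) (hC4 : C₀.card ≤ 4)
    (hCi : rk N C₀ = C₀.card) (hcl : e ∈ clF N C₀)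
    (honly : ∀ X ⊆ (gr N).erase e, X.card + 2 = rk N (gr N) → rk N X = X.card → e ∈ clF N X → C₀ ⊆ X) :
    inCount N 4 e ≤ outCount N 5 e := by
  rcases Nat.lt_or_ge C₀.card 3 with h2 | h3
  · -- a triangle
    have hC2' : C₀.card = 2 := by omega
    obtain ⟨f, g, hfg, rfl⟩ := card_eq_two.1 hC2'
    have hf' : f ∈ (gr N).erase e := hC (mem_insert_self f {g})
    have hg' : g ∈ (gr N).erase e := hC (mem_insert_of_mem (mem_singleton_self g))
    rw [card_pair hfg] at hCi
    exact inCount_four_le_outCount_five_of_triangle_six hn (by omega) he (mem_erase.1 hf').2 (mem_erase.1 hg').2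
      (mem_erase.1 hf').1.symm (mem_erase.1 hg').1.symm hfg hnc hll hcf hCi hcl
      (fun X hX hX2 hXr hXe => ⟨honly X hX hX2 hXr hXe (mem_insert_self f {g}),
        honly X hX hX2 hXr hXe (mem_insert_of_mem (mem_singleton_self g))⟩)
  rcases Nat.lt_or_ge C₀.card 4 with h3' | h4
  · -- a 4-circuit
    exact inCount_four_le_outCount_five_of_fourCircuit_of_six' hn hR he hnc hcf hC (by omega) hcl honly
  · -- a 5-circuit
    exact inCount_four_le_outCount_five_of_fiveCircuit_of_six hn hR he hnc hC (by omega) hcl honly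

end FourCircuit

end PercRepro.Cogirth
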